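import Summits.BirchSwinnertonDyer.BirchSwinnertonDyer.Theses.TameQuarticManinParity
import HarnessLib

/-!
# Route `TameQuarticManinParity` — the two degree-split GLUE items (LINE 8 / LINE 9) closed by name

HONEST FRAMING. This file proves the two pure-logic glue decls of route `TameQuarticManinParity` rev 2:

* `TprimeIrrOfDegreeSplit` (item stmt-BirchSwinnertonDyer-24500, LINE 8 glue):
  `TprimeIrrManinUnitOfThreeDvdDegree → TprimeIrrManinUnitOfDegreePrimeToThree → TprimeIrreducibleManinUnit`;
* `TprimeRedOfDegreeSplit` (item stmt-BirchSwinnertonDyer-24629, LINE 9 glue):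
  `TprimeRedManinUnitOfThreeDvdDegree → TprimeRedManinUnitOfDegreePrimeToThree → TprimeReducibleManinUnit`.

Both are the case split `3 ∣ D.modularDegree` / `¬ 3 ∣ D.modularDegree` on the optimal datum `D`, exactly as
certified in the planner's seat sketches (bsd-idea-3 g3, tqmp/Sketch8.lean, tqmp/Sketch9.lean). The four children
(the two ČNS halves and the two hard halves) remain HYPOTHESES: nothing here is progress on the Manin `3`-unit
itself, and BSD is not proved by any of this.
-/

-- D-0017: single-problem summit, so `Summit.BirchSwinnertonDyer.BirchSwinnertonDyer.…` repeats a namespace BY DESIGN.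
set_option linter.dupNamespace false

namespace Summit.BirchSwinnertonDyer.BirchSwinnertonDyer.Theorems.TameQuarticManinParity

open Summit.BirchSwinnertonDyer.BirchSwinnertonDyer.Theses.TameQuarticManinParity

/-- **LINE 8 glue** (item stmt-BirchSwinnertonDyer-24500): the hard half (`3 ∣ deg φ`) and the ČNS half
(`3 ∤ deg φ`) of the irreducible (t′)@3 Manin `3`-unit together give `TprimeIrreducibleManinUnit`, by cases on
`3 ∣ D.modularDegree`. Pure logic (planner sketch tqmp/Sketch8.lean, theorem `tprimeIrr_of_degreeSplit`). -/
theorem tprimeIrrOfDegreeSplit_proof : TprimeIrrOfDegreeSplit := by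
  unfold TprimeIrrOfDegreeSplit
  intro h₃ h₁ W _ _ _ hcm hadd ht hirr D hlat hmin
  by_cases hdeg : 3 ∣ D.modularDegree
  · exact h₃ W hcm hadd ht hirr D hlat hmin hdeg
  · exact h₁ W hcm hadd ht hirr D hlat hmin hdeg

/-- **LINE 9 glue** (item stmt-BirchSwinnertonDyer-24629): the hard half (`3 ∣ deg φ`) and the ČNS half
(`3 ∤ deg φ`) of the REDUCIBLE (t′)@3 Manin `3`-unit together give `TprimeReducibleManinUnit`, by cases on
`3 ∣ D.modularDegree`. Pure logic (planner sketch tqmp/Sketch9.lean, theorem `tprimeRed_of_degreeSplit`). -/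
theorem tprimeRedOfDegreeSplit_proof : TprimeRedOfDegreeSplit := by
  unfold TprimeRedOfDegreeSplit
  intro h₃ h₁ W _ _ _ hcm hadd ht hred D hlat hmin
  by_cases hdeg : 3 ∣ D.modularDegree
  · exact h₃ W hcm hadd ht hred D hlat hmin hdeg
  · exact h₁ W hcm hadd ht hred D hlat hmin hdeg

end Summit.BirchSwinnertonDyer.BirchSwinnertonDyer.Theorems.TameQuarticManinParity
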